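import Summits.BirchSwinnertonDyer.BirchSwinnertonDyer.Theorems.EisensteinDepletionAtTwoStarOptBNSFKummerAlg
import HarnessLib

/-!
# The Kummer form's `q`-expansion algebra — even-multiple variant (line `star` v18, toward stub S2 `stub_evenKummerForm`; crux E1M,
# stmt-BirchSwinnertonDyer-20341; lead star-p1 GEN 21)

Line nsf's `KummerAlg.stub_kummerAlg` (crux `StarOptBNSF`) derives the integrality of the Kummer form's expansion from «`2B ∈ ℤ⟦z⟧`»
(the FORMAL 2-torsion point's square root) and «`z ∈ ℤ⟦q⟧`».  In the ÉTALE case with an EVEN Manin multiple the square root `B` itself has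
unbounded 2-power denominators, but the SUBSTITUTED series `B(z)` is integral (the even-multiple square law).  This file records the variant
`kummerAlg_of_substInt` with exactly that hypothesis; the proof is the nsf proof verbatim with one line changed.  Pure power-series algebra;
nothing here reads `r_an`; E1M / BSD are NOT proved by this file.
-/

set_option linter.dupNamespace false
set_option autoImplicit false

noncomputable section

open PowerSeries
open Literature.NumberTheory.EllipticCurves

namespace Summit.BirchSwinnertonDyer.BirchSwinnertonDyer.Theorems.DepletionAtTwo.KummerAlg

/-- **The Kummer form's integrality algebra with an INTEGRAL substituted square root** (the even-multiple variant of line nsf's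
`KummerAlg.stub_kummerAlg`): the hypothesis `2B ∈ ℤ⟦z⟧` of the formal case is replaced by `B(z) ∈ ℤ⟦q⟧` for the substituted series
(given as `Bint`); same identities (i) `PΦ·z² = X(z)·PG`, (ii) `Ph²·z⁴ = (zB(z))²·PG²`; same conclusions (a) `PΦ` rational,
(b) `D·PΦ ∈ ℤ⟦q⟧ ⇒ 2D·Ph ∈ ℤ⟦q⟧`.  Proof verbatim with `(2B)(z)` replaced by `2·Bint`. [cite: SilvermanAEC2009, IV.1.1] [folklore] -/
theorem kummerAlg_of_substInt :
    ∀ (W₁ : WeierstrassCurve ℚ) [W₁.IsElliptic] [W₁.IsGloballyMinimal]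
      (B : PowerSeries ℚ), PowerSeries.constantCoeff B = 1 →
      ∀ (zq : PowerSeries ℤ), PowerSeries.constantCoeff zq = 0 → PowerSeries.coeff 1 zq ≠ 0 →
      ∀ (Bint : PowerSeries ℤ), PowerSeries.map (Int.castRingHom ℚ) Bint = B.subst (PowerSeries.map (Int.castRingHom ℚ) zq) →
      ∀ (Ph PΦ PG : PowerSeries ℂ), (∀ n : ℕ, ∃ r : ℚ, PowerSeries.coeff n PG = (r : ℂ)) →
      PΦ * (PowerSeries.map (Int.castRingHom ℂ) zq) ^ 2 =
          PowerSeries.map (algebraMap ℚ ℂ) (W₁.formalXMulSq.subst (PowerSeries.map (Int.castRingHom ℚ) zq)) * PG →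
      Ph ^ 2 * (PowerSeries.map (Int.castRingHom ℂ) zq) ^ 4 =
          (PowerSeries.map (algebraMap ℚ ℂ)
            (PowerSeries.map (Int.castRingHom ℚ) zq * B.subst (PowerSeries.map (Int.castRingHom ℚ) zq))) ^ 2 * PG ^ 2 →
      (∀ n : ℕ, ∃ r : ℚ, PowerSeries.coeff n PΦ = (r : ℂ)) ∧
      ∀ (D : ℕ), D ≠ 0 → (∀ n : ℕ, ∃ z : ℤ, PowerSeries.coeff n (PowerSeries.C (D : ℂ) * PΦ) = (z : ℂ)) →
        ∀ n : ℕ, ∃ z : ℤ, PowerSeries.coeff n (PowerSeries.C ((2 * D : ℕ) : ℂ) * Ph) = (z : ℂ) := by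
  intro W₁ _ _ B hB0 zq hz0 hz1 Bint hBint Ph PΦ PG hPG hi hii
  -- names
  set zQ : PowerSeries ℚ := PowerSeries.map (Int.castRingHom ℚ) zq with hzQ
  set zC : PowerSeries ℂ := PowerSeries.map (Int.castRingHom ℂ) zq with hzC
  set Xz : PowerSeries ℚ := W₁.formalXMulSq.subst zQ with hXz
  set Bz : PowerSeries ℚ := B.subst zQ with hBz
  have hinj : Function.Injective (algebraMap ℚ ℂ) := (algebraMap ℚ ℂ).injective
  have hzQ0 : constantCoeff zQ = 0 := by rw [hzQ, constantCoeff_map', hz0, map_zero]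
  have hsQ : HasSubst zQ := HasSubst.of_constantCoeff_zero' hzQ0
  have hzCQ : PowerSeries.map (algebraMap ℚ ℂ) zQ = zC := map_rat_map_int zq
  have hzQC0 : constantCoeff (PowerSeries.map (algebraMap ℚ ℂ) zQ) = 0 := by
    rw [constantCoeff_map', hzQ0, map_zero]
  have hsQC : HasSubst (PowerSeries.map (algebraMap ℚ ℂ) zQ) := HasSubst.of_constantCoeff_zero' hzQC0
  -- `zq = X * v`, `v(0) ≠ 0`
  obtain ⟨v, hv⟩ : X ∣ zq := X_dvd_iff.mpr hz0
  have hv0 : constantCoeff v ≠ 0 := by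
    have h := congrArg (coeff 1) hv
    rw [coeff_succ_X_mul, coeff_zero_eq_constantCoeff] at h
    rwa [h] at hz1
  have hzC_eq : zC = X * PowerSeries.map (Int.castRingHom ℂ) v := by
    rw [hzC, hv, map_mul, map_X]
  have hzC_ne : zC ≠ 0 := by
    intro h0
    have h := congrArg (coeff 1) h0
    rw [hzC, coeff_map, map_zero, eq_intCast, Int.cast_eq_zero] at h
    exact hz1 h
  -- the rational `PG`
  obtain ⟨PGq, hPGq⟩ := exists_map_eq_of_forall_rat hPG
  ------------------------------------------------------------------
  -- (a) rationality of `PΦ`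
  ------------------------------------------------------------------
  have hR : PΦ * (PowerSeries.map (Int.castRingHom ℂ) v) ^ 2 * X ^ 2 =
      PowerSeries.map (algebraMap ℚ ℂ) (Xz * PGq) := by
    rw [map_mul, hPGq, ← hi, hzC_eq]
    ring
  -- the first two coefficients of `Xz * PGq` vanish
  have hlow : ∀ m < 2, coeff m (Xz * PGq) = 0 := by
    intro m hm
    apply hinj
    rw [← coeff_map, ← hR, coeff_mul_X_pow', if_neg (by omega), map_zero]
  obtain ⟨Q, hQ⟩ : X ^ 2 ∣ Xz * PGq := X_pow_dvd_iff.mpr hlow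
  have hPΦv : PΦ * (PowerSeries.map (Int.castRingHom ℂ) v) ^ 2 = PowerSeries.map (algebraMap ℚ ℂ) Q := by
    have h : PΦ * (PowerSeries.map (Int.castRingHom ℂ) v) ^ 2 * X ^ 2 =
        PowerSeries.map (algebraMap ℚ ℂ) Q * X ^ 2 := by
      rw [hR, hQ, map_mul, map_pow, map_X, mul_comm]
    exact mul_right_cancel₀ (pow_ne_zero 2 X_ne_zero) h
  -- `v` is a unit of `ℚ⟦q⟧`
  set vQ : PowerSeries ℚ := PowerSeries.map (Int.castRingHom ℚ) v with hvQ
  have hvQ0 : constantCoeff vQ ≠ 0 := by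
    rw [hvQ, constantCoeff_map', eq_intCast]
    exact_mod_cast hv0
  have hvC : PowerSeries.map (algebraMap ℚ ℂ) vQ = PowerSeries.map (Int.castRingHom ℂ) v := map_rat_map_int v
  have hPΦ : PΦ = PowerSeries.map (algebraMap ℚ ℂ) (Q * (vQ⁻¹) ^ 2) := by
    have hne : (PowerSeries.map (Int.castRingHom ℂ) v) ^ 2 ≠ 0 := by
      refine pow_ne_zero 2 fun h0 ↦ hv0 ?_
      have h := congrArg constantCoeff h0
      rw [constantCoeff_map', map_zero, eq_intCast, Int.cast_eq_zero] at h
      exact h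
    refine mul_right_cancel₀ hne ?_
    rw [hPΦv, ← hvC, ← map_pow, ← map_mul, mul_assoc, ← mul_pow, PowerSeries.inv_mul_cancel vQ hvQ0, one_pow,
      mul_one]
  have hΦrat : ∀ n : ℕ, ∃ r : ℚ, coeff n PΦ = (r : ℂ) := fun n ↦ by
    rw [hPΦ]; exact forall_rat_of_map _ n
  refine ⟨hΦrat, ?_⟩
  ------------------------------------------------------------------
  -- (b) integrality of `2D·Ph`
  ------------------------------------------------------------------
  intro D hD hDint n
  -- the key square identity `(Ph·X(z))² = (zB(z)·PΦ)²`
  have hsq : (Ph * PowerSeries.map (algebraMap ℚ ℂ) Xz) * (Ph * PowerSeries.map (algebraMap ℚ ℂ) Xz) =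
      (PowerSeries.map (algebraMap ℚ ℂ) (zQ * Bz) * PΦ) * (PowerSeries.map (algebraMap ℚ ℂ) (zQ * Bz) * PΦ) := by
    have hne : zC ^ 4 ≠ 0 := pow_ne_zero 4 hzC_ne
    refine mul_right_cancel₀ hne ?_
    have e1 : Ph * PowerSeries.map (algebraMap ℚ ℂ) Xz * (Ph * PowerSeries.map (algebraMap ℚ ℂ) Xz) * zC ^ 4 =
        (Ph ^ 2 * zC ^ 4) * (PowerSeries.map (algebraMap ℚ ℂ) Xz) ^ 2 := by ring
    have e2 : PowerSeries.map (algebraMap ℚ ℂ) (zQ * Bz) * PΦ * (PowerSeries.map (algebraMap ℚ ℂ) (zQ * Bz) * PΦ) *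
        zC ^ 4 = (PowerSeries.map (algebraMap ℚ ℂ) (zQ * Bz)) ^ 2 * (PΦ * zC ^ 2) ^ 2 := by ring
    rw [e1, e2, hii, hi]
    ring
  -- a sign `ε = ±1`
  obtain ⟨ε, hε⟩ : ∃ ε : ℤ, Ph * PowerSeries.map (algebraMap ℚ ℂ) Xz =
      C (ε : ℂ) * (PowerSeries.map (algebraMap ℚ ℂ) (zQ * Bz) * PΦ) := by
    rcases mul_self_eq_mul_self_iff.mp hsq with h | h
    · exact ⟨1, by rw [h, Int.cast_one, map_one, one_mul]⟩
    · exact ⟨-1, by rw [h, Int.cast_neg, Int.cast_one, map_neg, map_one, neg_one_mul]⟩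
  -- integer structures
  obtain ⟨Xℤ, hXℤ0, hXℤ⟩ := exists_int_formalXMulSq W₁
  set Xℤz : PowerSeries ℤ := Xℤ.subst zq with hXℤz
  have hXℤz_map : PowerSeries.map (Int.castRingHom ℂ) Xℤz = PowerSeries.map (algebraMap ℚ ℂ) Xz := by
    rw [hXℤz, map_int_subst hz0, hXz, map_rat_subst hzQ0, ← hXℤ]
    simp only [hzQ, map_rat_map_int]
  have hXℤz0 : constantCoeff Xℤz = 1 := by
    rw [hXℤz, constantCoeff_subst_of_constantCoeff_eq_zero hz0, hXℤ0]
  set Y : PowerSeries ℤ := Xℤz.invOfUnit 1 with hY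
  have hXY : Xℤz * Y = 1 := PowerSeries.mul_invOfUnit Xℤz 1 (by rw [hXℤz0, Units.val_one])
  -- `B(z) ∈ ℤ⟦q⟧` (the even-multiple square law, given as the integral series `Bint`)
  set B2 : PowerSeries ℤ := C (2 : ℤ) * Bint with hB2def
  have hB2z : PowerSeries.map (Int.castRingHom ℂ) B2 = C (2 : ℂ) * PowerSeries.map (algebraMap ℚ ℂ) Bz := by
    rw [hB2def, map_mul, map_C, eq_intCast, Int.cast_ofNat, ← map_rat_map_int Bint, hBint, hBz]
  -- `D·PΦ ∈ ℤ⟦q⟧`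
  obtain ⟨TΦ, hTΦ⟩ := exists_map_eq_of_forall_int hDint
  -- assemble: `C(2D)·Ph·X(z) = ε·zq·B2(z)·TΦ`
  have hmain : C ((2 * D : ℕ) : ℂ) * Ph * PowerSeries.map (Int.castRingHom ℂ) Xℤz =
      PowerSeries.map (Int.castRingHom ℂ) (C ε * (zq * B2 * TΦ)) := by
    have e1 : C ((2 * D : ℕ) : ℂ) * Ph * PowerSeries.map (Int.castRingHom ℂ) Xℤz =
        C (2 : ℂ) * C (D : ℂ) * (Ph * PowerSeries.map (algebraMap ℚ ℂ) Xz) := by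
      rw [hXℤz_map, Nat.cast_mul, Nat.cast_two, map_mul]; ring
    rw [e1, hε, map_mul, map_mul, map_mul, map_mul, map_C, hB2z, hTΦ, eq_intCast,
      show PowerSeries.map (algebraMap ℚ ℂ) zQ = PowerSeries.map (Int.castRingHom ℂ) zq from map_rat_map_int zq]
    ring
  -- multiply by the inverse `Y` of `X(z)` in `ℤ⟦q⟧`
  have hfinal : C ((2 * D : ℕ) : ℂ) * Ph =
      PowerSeries.map (Int.castRingHom ℂ) (C ε * (zq * B2 * TΦ) * Y) := by
    calc C ((2 * D : ℕ) : ℂ) * Ph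
        = C ((2 * D : ℕ) : ℂ) * Ph * PowerSeries.map (Int.castRingHom ℂ) (Xℤz * Y) := by
          rw [hXY, map_one, mul_one]
      _ = (C ((2 * D : ℕ) : ℂ) * Ph * PowerSeries.map (Int.castRingHom ℂ) Xℤz) * PowerSeries.map (Int.castRingHom ℂ) Y := by
          rw [map_mul]; ring
      _ = PowerSeries.map (Int.castRingHom ℂ) (C ε * (zq * B2 * TΦ) * Y) := by
          rw [hmain, ← map_mul]
  exact ⟨coeff n (C ε * (zq * B2 * TΦ) * Y), by rw [hfinal, coeff_map, eq_intCast]⟩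

end Summit.BirchSwinnertonDyer.BirchSwinnertonDyer.Theorems.DepletionAtTwo.KummerAlg

end
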